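import Mathlib
import HarnessLib
import Summits.RiemannHypothesis.RiemannHypothesis.Theses.WeilParity
import Literature.NumberTheory.LFunctions.WeilGroundEnergyParitySplit
import Literature.NumberTheory.LFunctions.WeilWindowSimpleEven

/-!
# Line `ladder` — skeleton for the piece `NoParityCrossing` (stmt-RiemannHypothesis-18085) of route
# WeilParity: the `{2,3}`-window certificate plus Connes' clause on the tail

Piece (route leaf, child of the crux `EvenWinsBeyondArch`; the RH-bearing residue, parity-symmetric):
for every `a > (log 3)/2` the even and odd sector bottoms of Weil's windowed form never tie,
`weilEvenGroundEnergy a ≠ weilOddGroundEnergy a`.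

## THE LINE: the prime ladder — certify the next structural window, bet on Connes beyond it

The windows are stratified by the prime powers present: `(log 3)/2 < a ≤ log 2` is the
`{2,3}`-WINDOW (prime powers `2, 3`; `4` enters at `a = log 2`).  On it the order is still a finite,
RH-free statement, numerically resolved with a huge margin (`o1/e1 = 250 → 625`,
`e1 = 4e-8 → 7.7e-13`, sister `Cruxes/GroundStateSimpleEven/Disproof.lean`, converged N = 22/30/38 at
`a = log 2`) but at the EDGE of certified reach: the odd-sector lower bound needed at `c = log 2` is
`≈ 5e-10` absolute (the floating-point precision wall B2 sits at `a ≈ 0.75`; for certified bounds it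
has never been located).  Beyond `log 2` the statement is Connes' "lowest eigenvalue simple and even"
(`WeilWindowSimpleEven`, Connes2026Letter §6.6, ConnesSuijlekom2025 Thm 6.1 hypothesis) on the tail —
the RH content proper (under `¬RH` it fails by `OffLineParityDetection`; under RH it is the prolate
picture, sector defects `1 − λ₀(c) ≪ 1 − λ₁(c)` with ratio growing like `c²`; data `o1/e1 = 625 → 2569
→ ≈6000` on `[log 2, 1.2]`, monotone), shared in substance with route `WeilGroundState`'s residue
`stub_oddSectorGap_large`.

* `stub_twoThreeWindowSimpleEven` — `WeilWindowSimpleEven a` for `(log 3)/2 < a ≤ log 2`.  RH-free;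
  size XL (≈ 4–5 cells of width ≈ 0.03 by the cell-transfer method of line `cells` of the sibling
  piece, with certified odd lower bounds down to 5e-10).  Why it might fail: only by the precision
  wall (certification cost), not mathematically (margin > 250×).
* `stub_tailSimpleEven` — `WeilWindowSimpleEven a` for `a > log 2`.  RH-strength; size open-problem.
  Why it might fail: RH-strength by design; and even under RH no mechanism beyond the prolate
  heuristic is in hand (no zero-blind lever: von Neumann–Wigner, C^∞-non-analytic family in `a`).

Composition (sorry-free): either stub gives `WeilWindowSimpleEven a` at the window, which forces the
STRICT order `ε_ev(a) < ε_od(a)` (`ε_od ≥ ε + δ > ε = min(ε_ev, ε_od)`), hence `≠`.  Neither stub is the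
piece reworded: both assert the NAMED literature clause (simple + isolated + even, with parity), on
ranges that do not cover the piece's alone; the piece is sign-blind.  Hardest stub:
`stub_tailSimpleEven`.  Disproof used: none exists (2026-08-17).  Dead lines: none.  A second,
mechanism line for this piece is wanted (crux-ideate): candidates recorded in the strategist's
DECOMPOSITION.md (monotone parity ratio — needs positivity; folding lever `|o|` — marginal; division
lever `∫o` under RH — calibration only).
-/

set_option linter.dupNamespace false
set_option linter.unusedVariables false

noncomputable section

namespace Summit.RiemannHypothesis.RiemannHypothesis.Cruxes.NoParityCrossing.Ladder

open MeasureTheory Set Filter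
open scoped Real Topology
open Literature.NumberTheory.LFunctions
open Summit.RiemannHypothesis.RiemannHypothesis.Theses.WeilParity

/-! ## The two registered stubs -/

/-- **Stub 1 — the `{2,3}`-window** (prime powers `2` and `3` present, `4` enters at `log 2`): the
Connes–van Suijlekom clause holds for `(log 3)/2 < a ≤ log 2`. RH-free, certifiable by cell transfer
at the edge of the precision wall. [cite: ConnesSuijlekom2025, Thm. 6.1 (hypothesis)] -/
theorem stub_twoThreeWindowSimpleEven :
    ∀ a : ℝ, Real.log 3 / 2 < a → a ≤ Real.log 2 →
      Literature.NumberTheory.LFunctions.WeilWindowSimpleEven a := by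
  sorry

/-- **Stub 2 — Connes' clause on the tail**: `WeilWindowSimpleEven a` for every `a > log 2` (the
RH-bearing residue of route WeilParity and, in substance, of route WeilGroundState).
[cite: Connes2026Letter, §6.6] -/
theorem stub_tailSimpleEven :
    ∀ a : ℝ, Real.log 2 < a → Literature.NumberTheory.LFunctions.WeilWindowSimpleEven a := by
  sorry

/-! ## Sorry-free infrastructure -/

/-- **`WeilWindowSimpleEven a` forces `ε_ev(a) < ε_od(a)`** (`a > 0`). [folklore] -/
theorem weilEvenGroundEnergy_lt_weilOddGroundEnergy_of_weilWindowSimpleEven {a : ℝ} (ha : 0 < a)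
    (h : WeilWindowSimpleEven a) : weilEvenGroundEnergy a < weilOddGroundEnergy a := by
  obtain ⟨φ, δ, hδ, hgap⟩ := h
  have hodd : weilGroundEnergy a + δ ≤ weilOddGroundEnergy a :=
    le_weilOddGroundEnergy_of_forall ha fun g hg hs ho hn ↦ hgap g hg hs hn (Or.inl ho)
  have hmin := weilGroundEnergy_eq_min_even_odd a
  rcases min_cases (weilEvenGroundEnergy a) (weilOddGroundEnergy a) with ⟨h1, h2⟩ | ⟨h1, h2⟩
  · rw [hmin, h1] at hodd
    linarith
  · rw [hmin, h1] at hodd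
    linarith

/-- `0 < (log 3)/2`. [folklore] -/
theorem log_three_half_pos : 0 < Real.log 3 / 2 :=
  div_pos (Real.log_pos (by norm_num)) two_pos

/-! ## The composition: the two stubs prove the piece BY NAME -/

/-- **Composition with explicit hypotheses** (`stub₁-sig → stub₂-sig → piece unfolded`): at a window
`a > (log 3)/2` one of the two stubs gives the clause, the clause gives the strict order, and a strict
inequality is not an equality. Sorry-free. [folklore] -/
theorem noParityCrossing_of_stubs
    (h₁ : ∀ a : ℝ, Real.log 3 / 2 < a → a ≤ Real.log 2 →
      Literature.NumberTheory.LFunctions.WeilWindowSimpleEven a)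
    (h₂ : ∀ a : ℝ, Real.log 2 < a → Literature.NumberTheory.LFunctions.WeilWindowSimpleEven a) :
    ∀ a : ℝ, Real.log 3 / 2 < a →
      Literature.NumberTheory.LFunctions.weilEvenGroundEnergy a ≠
        Literature.NumberTheory.LFunctions.weilOddGroundEnergy a := by
  intro a ha
  have ha0 : 0 < a := log_three_half_pos.trans ha
  have hW : WeilWindowSimpleEven a := by
    rcases le_or_gt a (Real.log 2) with hle | hlt
    · exact h₁ a ha hle
    · exact h₂ a hlt
  exact (weilEvenGroundEnergy_lt_weilOddGroundEnergy_of_weilWindowSimpleEven ha0 hW).ne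

/-- **THE SKELETON THEOREM.** The piece
`Summit.RiemannHypothesis.RiemannHypothesis.Theses.WeilParity.NoParityCrossing`, concluded BY NAME from
the two DECLARED stubs (the only `sorry`s of the file) through the sorry-free composition
`noParityCrossing_of_stubs`. [folklore] -/
theorem NoParityCrossing_of :
    Summit.RiemannHypothesis.RiemannHypothesis.Theses.WeilParity.NoParityCrossing :=
  noParityCrossing_of_stubs stub_twoThreeWindowSimpleEven stub_tailSimpleEven

end Summit.RiemannHypothesis.RiemannHypothesis.Cruxes.NoParityCrossing.Ladder

end
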